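import Literature.NumberTheory.Sieve.SmoothZetaDecayBlocks
import Literature.NumberTheory.Sieve.SmoothZetaDecayRanges
import HarnessLib

/-!
# The total decay sum `W(t) = Σ_{p ≤ y} p^{-σ}(1 - cos(t log p))`: summing the block and range bounds

Topic `Literature/NumberTheory/Sieve`; a PROVED tool file. The tree bounds the contribution of one block `(z/e³, z]`
(`exists_blockDecaySum_ge`, Brun–Titchmarsh regime `3 ≤ |t| ≤ κ z^{9/10}`) and of one range `(z e^{-Λ}, z]`
(`exists_rangeDecaySum_ge`, Chebyshev regime `0 < |t| ≤ 3`) to Hildebrand–Tenenbaum's decay sum `W`, for which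
`|ζ(σ + it, y)| ≤ ζ(σ, y) e^{-W}` (`norm_smoothZetaC_le_mul_exp_neg_decaySum`). Here the block bounds are summed over
the blocks `z = y, y/e³, …, ≥ √y` with the tree's `sum_blocks_rpow_ge`:

* `decaySum_mono` — `W` dominates its restriction to any set of primes `≤ y`;
* `exists_decaySum_ge_of_three_le` — there are absolute `c, κ > 0`, `y₀` with
  `W ≥ c e^{-3(1-σ)} (y^{1-σ} - y^{(1-σ)/2})/(3 (1-σ) log y)` for `y ≥ y₀`, `0 ≤ σ < 1`, `3 ≤ |t| ≤ κ y^{9/20}`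
  — Hildebrand–Tenenbaum's `W ≫ (y^{1-α} - 1)/((1-α) log y) ≍ ū` [Lemma 8 (ii), proof of (3.16)] in this range;
* `exists_decaySum_ge_of_le_three` — there are absolute `c > 0`, `y₀` with
  `W ≥ c (y e^{-Λ})^{1-σ}/log y`, `Λ = 4 + 1/(5|t|)`, for `y ≥ y₀`, `0 ≤ σ ≤ 1`, `0 < |t| ≤ 3`, `π/log y ≤ |t|`
  (the top range alone).

No information on the zeros of `ζ` is used anywhere. [cite: HildebrandTenenbaum1986, §3 Lemma 8 (ii), (3.16)]

## References

* [HildebrandTenenbaum1986] A. Hildebrand, G. Tenenbaum, Trans. AMS 296 (1986) 265–290, §3 Lemma 8 (ii) and the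
  proof of (3.16) (held: `paper:doi-10-1090-s0002-9947-1986-0837811-1`, pp. 275–276).
-/

noncomputable section

open Real Finset

namespace Literature.NumberTheory.Sieve

variable {σ t : ℝ} {y : ℕ}

/-- `W` dominates its restriction to any subset of the primes `≤ y` (the terms are `≥ 0`). [folklore] -/
theorem decaySum_mono {S : Finset ℕ} (hS : S ⊆ Nat.primesLE y) (σ t : ℝ) :
    ∑ p ∈ S, (p : ℝ) ^ (-σ) * (1 - Real.cos (t * Real.log p)) ≤
      ∑ p ∈ Nat.primesLE y, (p : ℝ) ^ (-σ) * (1 - Real.cos (t * Real.log p)) :=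
  Finset.sum_le_sum_of_subset_of_nonneg hS fun p _ _ =>
    mul_nonneg (Real.rpow_nonneg (Nat.cast_nonneg p) _) (by linarith [Real.cos_le_one (t * Real.log p)])

/-- A block `primesLE ⌊z⌋ \ primesLE ⌊z'⌋` with `z ≤ y` consists of primes `≤ y`. [folklore] -/
theorem sdiff_primesLE_subset {z : ℝ} (hz : z ≤ y) (A : Finset ℕ) :
    Nat.primesLE ⌊z⌋₊ \ A ⊆ Nat.primesLE y := by
  intro p hp
  have hp1 := (Finset.mem_sdiff.1 hp).1
  rw [Nat.mem_primesLE] at hp1 ⊢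
  refine ⟨hp1.1.trans ?_, hp1.2⟩
  exact_mod_cast (Nat.floor_le_floor hz).trans (Nat.floor_natCast y).le

/-- **`W ≫ (y^{1-σ} - y^{(1-σ)/2})/((1-σ) log y)` for `3 ≤ |t| ≤ κ y^{9/20}`**: the block bounds of
`exists_blockDecaySum_ge` on `(y e^{-3(i+1)}, y e^{-3i}]`, `0 ≤ i ≤ ⌊log y/6⌋` (all these blocks lie above `√y`, where
`|t| ≤ κ (√y)^{9/10}` keeps them in the Brun–Titchmarsh regime), summed by `sum_blocks_rpow_ge`.
[cite: HildebrandTenenbaum1986, §3 Lemma 8 (ii), proof of (3.16)] -/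
theorem exists_decaySum_ge_of_three_le :
    ∃ c : ℝ, 0 < c ∧ ∃ κ : ℝ, 0 < κ ∧ ∃ y₀ : ℕ, ∀ y : ℕ, y₀ ≤ y → ∀ σ : ℝ, 0 ≤ σ → σ < 1 →
      ∀ t : ℝ, 3 ≤ |t| → |t| ≤ κ * (y : ℝ) ^ (9 / 20 : ℝ) →
        c * Real.exp (-(3 * (1 - σ))) * ((y : ℝ) ^ (1 - σ) - (y : ℝ) ^ ((1 - σ) / 2)) /
            (3 * (1 - σ) * Real.log y) ≤
          ∑ p ∈ Nat.primesLE y, (p : ℝ) ^ (-σ) * (1 - Real.cos (t * Real.log p)) := by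
  obtain ⟨c, hc, κ, hκ, z₀, hz₀, hblk⟩ := exists_blockDecaySum_ge
  refine ⟨c, hc, κ, hκ, max ⌈z₀ ^ 2⌉₊ 3, fun y hy σ hσ0 hσ1 t ht3 htκ => ?_⟩
  have hyz : z₀ ^ 2 ≤ y := le_trans (Nat.le_ceil _) (by exact_mod_cast le_trans (le_max_left _ _) hy)
  have hy3 : (3 : ℝ) ≤ y := by exact_mod_cast le_trans (le_max_right _ _) hy
  have hy0 : (0 : ℝ) < y := by linarith
  have hy1 : (1 : ℝ) < y := by linarith
  set z : ℝ := (y : ℝ) with hzdef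
  set L : ℝ := Real.log z with hL
  have hL0 : 0 < L := Real.log_pos hy1
  have hsqrt : Real.sqrt z = z ^ (1 / 2 : ℝ) := Real.sqrt_eq_rpow z
  have hz₀sqrt : z₀ ≤ Real.sqrt z := by
    rw [show z₀ = Real.sqrt (z₀ ^ 2) by rw [Real.sqrt_sq hz₀.le]]
    exact Real.sqrt_le_sqrt hyz
  set I : ℕ := ⌊L / 6⌋₊ with hI
  have hI6 : (I : ℝ) * 6 ≤ L := by
    have : (I : ℝ) ≤ L / 6 := Nat.floor_le (by positivity)
    linarith
  have hI6' : L < ((I : ℝ) + 1) * 6 := by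
    have : L / 6 < (I : ℝ) + 1 := Nat.lt_floor_add_one _
    linarith
  -- the blocks above `√y`
  have hzi : ∀ i : ℕ, i ≤ I → Real.sqrt z ≤ z * Real.exp (-((i : ℝ) * 3)) := by
    intro i hi
    have hi' : (i : ℝ) * 3 ≤ L / 2 := by
      have : (i : ℝ) ≤ I := by exact_mod_cast hi
      nlinarith
    rw [hsqrt, show z ^ (1 / 2 : ℝ) = Real.exp (L / 2) by
      rw [Real.rpow_def_of_pos hy0, hL]; ring_nf]
    calc Real.exp (L / 2) ≤ Real.exp (L + -((i : ℝ) * 3)) := Real.exp_le_exp.2 (by linarith)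
      _ = z * Real.exp (-((i : ℝ) * 3)) := by rw [Real.exp_add, hL, Real.exp_log hy0]
  have hblock : ∀ i : ℕ, i ≤ I → c * ((z * Real.exp (-((i + 1) * (3 : ℝ)))) ^ (1 - σ) / Real.log z) ≤
      ∑ p ∈ Nat.primesLE ⌊z * Real.exp (-(i * (3 : ℝ)))⌋₊ \ Nat.primesLE ⌊z * Real.exp (-((i + 1) * (3 : ℝ)))⌋₊,
        (p : ℝ) ^ (-σ) * (1 - Real.cos (t * Real.log p)) := by
    intro i hi
    set zi : ℝ := z * Real.exp (-((i : ℝ) * 3)) with hzi_def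
    have hzi_ge : Real.sqrt z ≤ zi := hzi i hi
    have hzi0 : 0 < zi := by positivity
    have hzi_z₀ : z₀ ≤ zi := hz₀sqrt.trans hzi_ge
    have hzi_le : zi ≤ z := by
      have : Real.exp (-((i : ℝ) * 3)) ≤ 1 := Real.exp_le_one_iff.2 (by
        have : (0 : ℝ) ≤ (i : ℝ) * 3 := by positivity
        linarith)
      exact mul_le_of_le_one_right hy0.le this
    have hzi1 : 1 < zi := by
      have : 1 < Real.sqrt z := by
        rw [show (1 : ℝ) = Real.sqrt 1 by simp]
        exact Real.sqrt_lt_sqrt (by norm_num) hy1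
      linarith
    -- `|t| ≤ κ zi^{9/10}` since `zi ≥ √z` and `(√z)^{9/10} = z^{9/20}`
    have htzi : |t| ≤ κ * zi ^ (9 / 10 : ℝ) := by
      refine htκ.trans (mul_le_mul_of_nonneg_left ?_ hκ.le)
      calc z ^ (9 / 20 : ℝ) = (Real.sqrt z) ^ (9 / 10 : ℝ) := by
            rw [hsqrt, ← Real.rpow_mul hy0.le]; norm_num
        _ ≤ zi ^ (9 / 10 : ℝ) := Real.rpow_le_rpow (Real.sqrt_nonneg _) hzi_ge (by norm_num)
    have h := hblk zi hzi_z₀ σ hσ0 t ht3 htzi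
    -- identify the block and compare the main terms
    have hset : zi * Real.exp (-3) = z * Real.exp (-(((i : ℝ) + 1) * 3)) := by
      rw [hzi_def, mul_assoc, ← Real.exp_add]; congr 1; ring
    rw [hset] at h
    refine le_trans ?_ h
    have hlogzi : Real.log zi ≤ Real.log z := Real.log_le_log hzi0 hzi_le
    have hlogzi0 : 0 < Real.log zi := Real.log_pos hzi1
    have hpow : (z * Real.exp (-(((i : ℝ) + 1) * 3))) ^ (1 - σ) ≤ zi ^ (1 - σ) := by
      refine Real.rpow_le_rpow (by positivity) ?_ (by linarith)
      rw [hzi_def, show -(((i : ℝ) + 1) * 3) = -((i : ℝ) * 3) + (-3) by ring, Real.exp_add, ← mul_assoc]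
      exact mul_le_of_le_one_right (by positivity) (Real.exp_le_one_iff.2 (by norm_num))
    calc c * ((z * Real.exp (-(((i : ℝ) + 1) * 3))) ^ (1 - σ) / Real.log z)
        ≤ c * (zi ^ (1 - σ) / Real.log z) := by gcongr
      _ ≤ c * (zi ^ (1 - σ) / Real.log zi) := by gcongr
  have hsum := sum_blocks_rpow_ge (g := fun p : ℕ => (p : ℝ) ^ (-σ) * (1 - Real.cos (t * Real.log p)))
    hy1 (by norm_num : (0 : ℝ) < 3) hσ1 hc.le I hblock
  -- the tail block endpoint is `≤ √y`
  have htail : (z * Real.exp (-((I + 1 : ℕ) * (3 : ℝ)))) ^ (1 - σ) ≤ z ^ ((1 - σ) / 2) := by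
    have h1 : z * Real.exp (-((I + 1 : ℕ) * (3 : ℝ))) ≤ z ^ (1 / 2 : ℝ) := by
      rw [show z ^ (1 / 2 : ℝ) = Real.exp (L / 2) by rw [Real.rpow_def_of_pos hy0, hL]; ring_nf,
        show z * Real.exp (-((I + 1 : ℕ) * (3 : ℝ))) = Real.exp (L + -((I + 1 : ℕ) * (3 : ℝ))) by
          rw [Real.exp_add, hL, Real.exp_log hy0]]
      refine Real.exp_le_exp.2 ?_
      push_cast
      linarith
    calc (z * Real.exp (-((I + 1 : ℕ) * (3 : ℝ)))) ^ (1 - σ) ≤ (z ^ (1 / 2 : ℝ)) ^ (1 - σ) :=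
          Real.rpow_le_rpow (by positivity) h1 (by linarith)
      _ = z ^ ((1 - σ) / 2) := by rw [← Real.rpow_mul hy0.le]; ring_nf
  have hβ : 0 < 1 - σ := by linarith
  have hden : 0 < 3 * (1 - σ) * Real.log z := by positivity
  calc c * Real.exp (-(3 * (1 - σ))) * (z ^ (1 - σ) - z ^ ((1 - σ) / 2)) / (3 * (1 - σ) * Real.log z)
      ≤ c * Real.exp (-(3 * (1 - σ))) * (z ^ (1 - σ) - (z * Real.exp (-((I + 1 : ℕ) * (3 : ℝ)))) ^ (1 - σ)) /
          (3 * (1 - σ) * Real.log z) := by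
        refine div_le_div_of_nonneg_right ?_ hden.le
        refine mul_le_mul_of_nonneg_left (by linarith) (by positivity)
    _ ≤ _ := hsum
    _ ≤ _ := decaySum_mono (sdiff_primesLE_subset (by rw [hzdef]) _) σ t

/-- **`W ≫ (y e^{-Λ})^{1-σ}/log y` for `0 < |t| ≤ 3`, `|t| ≥ π/log y`** (`Λ = 4 + 1/(5|t|)`): the top range
`(y e^{-Λ}, y]` of `exists_rangeDecaySum_ge` (`Λ ≤ 4 + log y/(5π) ≤ log y/2` once `log y ≥ 10`).
[cite: HildebrandTenenbaum1986, §3 Lemma 8 (ii)] -/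
theorem exists_decaySum_ge_of_le_three :
    ∃ c : ℝ, 0 < c ∧ ∃ y₀ : ℕ, ∀ y : ℕ, y₀ ≤ y → ∀ σ : ℝ, 0 ≤ σ → σ ≤ 1 →
      ∀ t : ℝ, t ≠ 0 → |t| ≤ 3 → Real.pi / Real.log y ≤ |t| →
        c * (((y : ℝ) * Real.exp (-(4 + 1 / (5 * |t|)))) ^ (1 - σ) / Real.log y) ≤
          ∑ p ∈ Nat.primesLE y, (p : ℝ) ^ (-σ) * (1 - Real.cos (t * Real.log p)) := by
  obtain ⟨c, hc, z₀, hz₀, hrng⟩ := exists_rangeDecaySum_ge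
  refine ⟨c, hc, max ⌈z₀⌉₊ ⌈Real.exp 10⌉₊, fun y hy σ hσ0 hσ1 t ht0 ht3 htπ => ?_⟩
  have hyz : z₀ ≤ y := le_trans (Nat.le_ceil _) (by exact_mod_cast le_trans (le_max_left _ _) hy)
  have hy10 : Real.exp 10 ≤ y := le_trans (Nat.le_ceil _) (by exact_mod_cast le_trans (le_max_right _ _) hy)
  have hy0 : (0 : ℝ) < y := lt_of_lt_of_le (Real.exp_pos _) hy10
  have hL10 : 10 ≤ Real.log y := by
    have := Real.log_le_log (Real.exp_pos _) hy10; rwa [Real.log_exp] at this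
  have htpos : 0 < |t| := abs_pos.2 ht0
  have hπ := Real.pi_gt_three
  -- `Λ ≤ log y / 2`
  have hΛ : 4 + 1 / (5 * |t|) ≤ Real.log y / 2 := by
    have h1 : 1 / (5 * |t|) ≤ Real.log y / (5 * Real.pi) := by
      rw [div_le_div_iff₀ (by positivity) (by positivity)]
      have := mul_le_mul_of_nonneg_left htπ (show (0 : ℝ) ≤ 5 by norm_num)
      have h2 : 5 * (Real.pi / Real.log y) * Real.log y = 5 * Real.pi := by field_simp
      nlinarith [h2]
    have h3 : Real.log y / (5 * Real.pi) ≤ Real.log y / 15 :=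
      div_le_div_of_nonneg_left (by linarith) (by norm_num) (by linarith)
    linarith
  exact (hrng y hyz σ hσ0 hσ1 t ht0 ht3 hΛ).trans (decaySum_mono (sdiff_primesLE_subset le_rfl _) σ t)

end Literature.NumberTheory.Sieve

end
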